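import Literature.NumberTheory.EllipticCurves.RationalIsogenyFrobeniusCriterionPrimePower
import Literature.NumberTheory.EllipticCurves.RationalIsogenyFrobeniusCertificates11
import Literature.NumberTheory.EllipticCurves.RationalIsogenyFrobeniusCertificates17
import Literature.NumberTheory.EllipticCurves.RationalIsogenyFrobeniusCertificates19and37
import Literature.NumberTheory.EllipticCurves.RationalIsogenyFrobeniusCertificatesCM
import HarnessLib

/-!
# Kenku's levels `p²`: no cyclic `ℚ`-isogeny of degree `p²` out of the `X₀(p)`-tabulated `j`,
# `p ∈ {11, 17, 19, 37, 43, 67, 163}` (prime-power Frobenius certificates)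

Topic `NumberTheory/EllipticCurves`; theorems only (no definition, no named fact). The eleven rows `(j, p²)`: the three `j` of `X₀(11)`, two of `X₀(17)`, one of `X₀(19)`, two of `X₀(37)`, and the CM values `-960³, -5280³, -640320³` (`X₀(43), X₀(67), X₀(163)`).
Mechanism (Mazur 1978, Prop. 6.3 (1), prime-power form; Kenku 1982, proof of Thm. 1): a cyclic
`ℚ`-isogeny of degree `pᵏ` out of `W` transports along `j(W) = j(E₀)` to a `Γ_ℚ`-stable cyclic
subgroup of order `pᵏ` on the tabulated globally minimal model `E₀`, whose character
`r : Γ_ℚ → (ℤ/pᵏ)ˣ` has `r(φ_ℓ)² − a_ℓ r(φ_ℓ) + ℓ ≡ 0 (mod pᵏ)` at a good prime `ℓ ≠ p` — the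
landed criterion `j_ne_of_isogeny_cyclic_primePow_degree_of_certificate`
(`RationalIsogenyFrobeniusCriterionPrimePower.lean`) fed with the kernel-decided rows `card_…` /
`noroot_…` of `RationalIsogenyFrobeniusCertificates*.lean`. These theorems are what replaces
Kenku's uniqueness schema ("two rational cyclic `N`-subgroups never coexist") in the radius form
of the Mazur–Kenku theorem (crux `MazurKenkuBound` of `Summits/ABC`, line `radius-lite`).

## References

* [Mazur1978] B. Mazur, *Rational isogenies of prime degree*, Invent. Math. 44 (1978) 129–162:
  §6 Prop. 6.3 (1) (p. 153), table p. 129.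
* [Kenku1982] M. A. Kenku, *On the number of ℚ-isomorphism classes of elliptic curves in each
  ℚ-isogeny class*, J. Number Theory 15 (1982) 199–202, proof of Thm. 1, pp. 200–201.
-/

noncomputable section

open scoped Classical
open WeierstrassCurve
open Literature.NumberTheory.EllipticCurves

namespace Literature.NumberTheory.EllipticCurves.KenkuLevelsCert

/-- The prime-power criterion `j_ne_of_isogeny_cyclic_primePow_degree_of_certificate` with the
arithmetic `a_ℓ = ℓ + 1 − n` and `m = pᵏ` pre-evaluated, so that each row is fed by its
kernel-decided witness verbatim. [cite: Mazur1978, §6 Prop. 6.3 (1) (p. 153)] -/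
private theorem j_ne_of_primePow_row (E₀ : WeierstrassCurve ℤ) {B : ℕ}
    (hB : E₀.Δ.natAbs < B ^ 12)
    (hdec : ∀ p ∈ Finset.range B, p.Prime →
      ¬ (p ^ 12 ∣ E₀.Δ.natAbs) ∨ ¬ (p ∣ E₀.c₄.natAbs))
    (hc₄ : E₀.c₄ ≠ 0) (hc₆ : E₀.c₆ ≠ 0)
    {ℓ : ℕ} [Fact ℓ.Prime] (hℓΔ : ¬ (ℓ ∣ E₀.Δ.natAbs)) {n : ℕ}
    (hcard : Nat.card ((E₀.map (Int.castRingHom (ZMod ℓ))).toAffine.Point) = n)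
    {p k : ℕ} [Fact p.Prime] (hℓp : ℓ ≠ p) {a : ℤ} (ha : (ℓ : ℤ) + 1 - n = a) {m : ℕ}
    (hm : p ^ k = m) (hnoroot : ∀ t : ZMod m, t ^ 2 - (a : ZMod m) * t + (ℓ : ZMod m) ≠ 0)
    {W W' : WeierstrassCurve ℚ} [W.IsElliptic] [W'.IsElliptic] (ψ : Isogeny W W')
    (hψ : ψ.IsCyclic) (hq : ψ.degree = m) : W.j ≠ (E₀.c₄ : ℚ) ^ 3 / (E₀.Δ : ℚ) := by
  subst hm ha
  exact j_ne_of_isogeny_cyclic_primePow_degree_of_certificate E₀ hB hdec hc₄ hc₆ hℓΔ hcard hℓp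
    hnoroot ψ hψ hq

/-- No cyclic `ℚ`-isogeny of degree `121 = 11²` out of an elliptic curve over `ℚ` with
`j = -32768`: model `[0, -1, 1, -7, 10]` (`Δ = -1331`), witness `ℓ = 3`, `#Ẽ(𝔽_3) = 5`,
`a_3 = -1`, and `X² - (-1)X + 3` has no root modulo `121` (`noroot_E11_jm32768_3_121`).
[cite: Mazur1978, §6 Prop. 6.3 (1) (p. 153)] [cite: Kenku1982, proof of Thm. 1, pp. 200–201] -/
theorem noCyclic121_jm32768 {W W' : WeierstrassCurve ℚ} [W.IsElliptic] [W'.IsElliptic]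
    (ψ : Isogeny W W') (hψ : ψ.IsCyclic) (hq : ψ.degree = 121) : W.j ≠ -32768 := by
  have hj : (((⟨0, -1, 1, -7, 10⟩ : WeierstrassCurve ℤ)).c₄ : ℚ) ^ 3 /
      (((⟨0, -1, 1, -7, 10⟩ : WeierstrassCurve ℤ)).Δ : ℚ) = -32768 := by
    norm_num [WeierstrassCurve.Δ, WeierstrassCurve.c₄, WeierstrassCurve.b₂, WeierstrassCurve.b₄,
      WeierstrassCurve.b₆, WeierstrassCurve.b₈]
  have hnr : ∀ t : ZMod 121, t ^ 2 - ((-1 : ℤ) : ZMod 121) * t + ((3 : ℕ) : ZMod 121) ≠ 0 := by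
    simpa using noroot_E11_jm32768_3_121
  rw [← hj]
  haveI : Fact (Nat.Prime 3) := ⟨by norm_num⟩
  haveI : Fact (Nat.Prime 11) := ⟨by norm_num⟩
  exact j_ne_of_primePow_row _ (B := 2) (by decide +kernel) (by decide +kernel) (by decide +kernel)
    (by decide +kernel) (ℓ := 3) (by decide +kernel) card_E11_jm32768_3 (p := 11)
    (k := 2) (by norm_num) (by norm_num) (by norm_num) hnr ψ hψ hq

/-- No cyclic `ℚ`-isogeny of degree `121 = 11²` out of an elliptic curve over `ℚ` with
`j = -121`: model `[1, 1, 0, -2, -7]` (`Δ = -14641`), witness `ℓ = 23`, `#Ẽ(𝔽_23) = 22`,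
`a_23 = 2`, and `X² - (2)X + 23` has no root modulo `121` (`noroot_E11_jm121_23_121`).
[cite: Mazur1978, §6 Prop. 6.3 (1) (p. 153)] [cite: Kenku1982, proof of Thm. 1, pp. 200–201] -/
theorem noCyclic121_jm121 {W W' : WeierstrassCurve ℚ} [W.IsElliptic] [W'.IsElliptic]
    (ψ : Isogeny W W') (hψ : ψ.IsCyclic) (hq : ψ.degree = 121) : W.j ≠ -121 := by
  have hj : (((⟨1, 1, 0, -2, -7⟩ : WeierstrassCurve ℤ)).c₄ : ℚ) ^ 3 /
      (((⟨1, 1, 0, -2, -7⟩ : WeierstrassCurve ℤ)).Δ : ℚ) = -121 := by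
    norm_num [WeierstrassCurve.Δ, WeierstrassCurve.c₄, WeierstrassCurve.b₂, WeierstrassCurve.b₄,
      WeierstrassCurve.b₆, WeierstrassCurve.b₈]
  have hnr : ∀ t : ZMod 121, t ^ 2 - ((2 : ℤ) : ZMod 121) * t + ((23 : ℕ) : ZMod 121) ≠ 0 := by
    simpa using noroot_E11_jm121_23_121
  rw [← hj]
  haveI : Fact (Nat.Prime 23) := ⟨by norm_num⟩
  haveI : Fact (Nat.Prime 11) := ⟨by norm_num⟩
  exact j_ne_of_primePow_row _ (B := 3) (by decide +kernel) (by decide +kernel) (by decide +kernel)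
    (by decide +kernel) (ℓ := 23) (by decide +kernel) card_E11_jm121_23 (p := 11)
    (k := 2) (by norm_num) (by norm_num) (by norm_num) hnr ψ hψ hq

/-- No cyclic `ℚ`-isogeny of degree `121 = 11²` out of an elliptic curve over `ℚ` with
`j = -24729001`: model `[1, 1, 1, -30, -76]` (`Δ = -121`), witness `ℓ = 23`, `#Ẽ(𝔽_23) = 22`,
`a_23 = 2`, and `X² - (2)X + 23` has no root modulo `121` (`noroot_E11_jm24729001_23_121`).
[cite: Mazur1978, §6 Prop. 6.3 (1) (p. 153)] [cite: Kenku1982, proof of Thm. 1, pp. 200–201] -/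
theorem noCyclic121_jm24729001 {W W' : WeierstrassCurve ℚ} [W.IsElliptic] [W'.IsElliptic]
    (ψ : Isogeny W W') (hψ : ψ.IsCyclic) (hq : ψ.degree = 121) : W.j ≠ -24729001 := by
  have hj : (((⟨1, 1, 1, -30, -76⟩ : WeierstrassCurve ℤ)).c₄ : ℚ) ^ 3 /
      (((⟨1, 1, 1, -30, -76⟩ : WeierstrassCurve ℤ)).Δ : ℚ) = -24729001 := by
    norm_num [WeierstrassCurve.Δ, WeierstrassCurve.c₄, WeierstrassCurve.b₂, WeierstrassCurve.b₄,
      WeierstrassCurve.b₆, WeierstrassCurve.b₈]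
  have hnr : ∀ t : ZMod 121, t ^ 2 - ((2 : ℤ) : ZMod 121) * t + ((23 : ℕ) : ZMod 121) ≠ 0 := by
    simpa using noroot_E11_jm24729001_23_121
  rw [← hj]
  haveI : Fact (Nat.Prime 23) := ⟨by norm_num⟩
  haveI : Fact (Nat.Prime 11) := ⟨by norm_num⟩
  exact j_ne_of_primePow_row _ (B := 2) (by decide +kernel) (by decide +kernel) (by decide +kernel)
    (by decide +kernel) (ℓ := 23) (by decide +kernel) card_E11_jm24729001_23 (p := 11)
    (k := 2) (by norm_num) (by norm_num) (by norm_num) hnr ψ hψ hq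

/-- No cyclic `ℚ`-isogeny of degree `289 = 17²` out of an elliptic curve over `ℚ` with
`j = -297756989/2`: model `[1, 0, 1, -3041, 64278]` (`Δ = -20880250`), witness `ℓ = 67`, `#Ẽ(𝔽_67) = 76`,
`a_67 = -8`, and `X² - (-8)X + 67` has no root modulo `289` (`noroot_E17_jm297756989d2_67_289`).
[cite: Mazur1978, §6 Prop. 6.3 (1) (p. 153)] [cite: Kenku1982, proof of Thm. 1, pp. 200–201] -/
theorem noCyclic289_jm297756989d2 {W W' : WeierstrassCurve ℚ} [W.IsElliptic] [W'.IsElliptic]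
    (ψ : Isogeny W W') (hψ : ψ.IsCyclic) (hq : ψ.degree = 289) : W.j ≠ -297756989 / 2 := by
  have hj : (((⟨1, 0, 1, -3041, 64278⟩ : WeierstrassCurve ℤ)).c₄ : ℚ) ^ 3 /
      (((⟨1, 0, 1, -3041, 64278⟩ : WeierstrassCurve ℤ)).Δ : ℚ) = -297756989 / 2 := by
    norm_num [WeierstrassCurve.Δ, WeierstrassCurve.c₄, WeierstrassCurve.b₂, WeierstrassCurve.b₄,
      WeierstrassCurve.b₆, WeierstrassCurve.b₈]
  have hnr : ∀ t : ZMod 289, t ^ 2 - ((-8 : ℤ) : ZMod 289) * t + ((67 : ℕ) : ZMod 289) ≠ 0 := by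
    simpa using noroot_E17_jm297756989d2_67_289
  rw [← hj]
  haveI : Fact (Nat.Prime 67) := ⟨by norm_num⟩
  haveI : Fact (Nat.Prime 17) := ⟨by norm_num⟩
  exact j_ne_of_primePow_row _ (B := 5) (by decide +kernel) (by decide +kernel) (by decide +kernel)
    (by decide +kernel) (ℓ := 67) (by decide +kernel) card_E17_jm297756989d2_67 (p := 17)
    (k := 2) (by norm_num) (by norm_num) (by norm_num) hnr ψ hψ hq

/-- No cyclic `ℚ`-isogeny of degree `289 = 17²` out of an elliptic curve over `ℚ` with
`j = -882216989/131072`: model `[1, 1, 0, -660, -7600]` (`Δ = -4734976000`), witness `ℓ = 67`, `#Ẽ(𝔽_67) = 76`,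
`a_67 = -8`, and `X² - (-8)X + 67` has no root modulo `289` (`noroot_E17_jm882216989d131072_67_289`).
[cite: Mazur1978, §6 Prop. 6.3 (1) (p. 153)] [cite: Kenku1982, proof of Thm. 1, pp. 200–201] -/
theorem noCyclic289_jm882216989d131072 {W W' : WeierstrassCurve ℚ} [W.IsElliptic] [W'.IsElliptic]
    (ψ : Isogeny W W') (hψ : ψ.IsCyclic) (hq : ψ.degree = 289) : W.j ≠ -882216989 / 131072 := by
  have hj : (((⟨1, 1, 0, -660, -7600⟩ : WeierstrassCurve ℤ)).c₄ : ℚ) ^ 3 /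
      (((⟨1, 1, 0, -660, -7600⟩ : WeierstrassCurve ℤ)).Δ : ℚ) = -882216989 / 131072 := by
    norm_num [WeierstrassCurve.Δ, WeierstrassCurve.c₄, WeierstrassCurve.b₂, WeierstrassCurve.b₄,
      WeierstrassCurve.b₆, WeierstrassCurve.b₈]
  have hnr : ∀ t : ZMod 289, t ^ 2 - ((-8 : ℤ) : ZMod 289) * t + ((67 : ℕ) : ZMod 289) ≠ 0 := by
    simpa using noroot_E17_jm882216989d131072_67_289
  rw [← hj]
  haveI : Fact (Nat.Prime 67) := ⟨by norm_num⟩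
  haveI : Fact (Nat.Prime 17) := ⟨by norm_num⟩
  exact j_ne_of_primePow_row _ (B := 7) (by decide +kernel) (by decide +kernel) (by decide +kernel)
    (by decide +kernel) (ℓ := 67) (by decide +kernel) card_E17_jm882216989d131072_67 (p := 17)
    (k := 2) (by norm_num) (by norm_num) (by norm_num) hnr ψ hψ hq

/-- No cyclic `ℚ`-isogeny of degree `361 = 19²` out of an elliptic curve over `ℚ` with
`j = -884736`: model `[0, 0, 1, -38, 90]` (`Δ = -6859`), witness `ℓ = 5`, `#Ẽ(𝔽_5) = 7`,
`a_5 = -1`, and `X² - (-1)X + 5` has no root modulo `361` (`noroot_E19_jm884736_5_361`).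
[cite: Mazur1978, §6 Prop. 6.3 (1) (p. 153)] [cite: Kenku1982, proof of Thm. 1, pp. 200–201] -/
theorem noCyclic361_jm884736 {W W' : WeierstrassCurve ℚ} [W.IsElliptic] [W'.IsElliptic]
    (ψ : Isogeny W W') (hψ : ψ.IsCyclic) (hq : ψ.degree = 361) : W.j ≠ -884736 := by
  have hj : (((⟨0, 0, 1, -38, 90⟩ : WeierstrassCurve ℤ)).c₄ : ℚ) ^ 3 /
      (((⟨0, 0, 1, -38, 90⟩ : WeierstrassCurve ℤ)).Δ : ℚ) = -884736 := by
    norm_num [WeierstrassCurve.Δ, WeierstrassCurve.c₄, WeierstrassCurve.b₂, WeierstrassCurve.b₄,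
      WeierstrassCurve.b₆, WeierstrassCurve.b₈]
  have hnr : ∀ t : ZMod 361, t ^ 2 - ((-1 : ℤ) : ZMod 361) * t + ((5 : ℕ) : ZMod 361) ≠ 0 := by
    simpa using noroot_E19_jm884736_5_361
  rw [← hj]
  haveI : Fact (Nat.Prime 5) := ⟨by norm_num⟩
  haveI : Fact (Nat.Prime 19) := ⟨by norm_num⟩
  exact j_ne_of_primePow_row _ (B := 3) (by decide +kernel) (by decide +kernel) (by decide +kernel)
    (by decide +kernel) (ℓ := 5) (by decide +kernel) card_E19_jm884736_5 (p := 19)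
    (k := 2) (by norm_num) (by norm_num) (by norm_num) hnr ψ hψ hq

/-- No cyclic `ℚ`-isogeny of degree `1369 = 37²` out of an elliptic curve over `ℚ` with
`j = -9317`: model `[1, 1, 1, -8, 6]` (`Δ = -6125`), witness `ℓ = 397`, `#Ẽ(𝔽_397) = 414`,
`a_397 = -16`, and `X² - (-16)X + 397` has no root modulo `1369` (`noroot_E37_jm9317_397_1369`).
[cite: Mazur1978, §6 Prop. 6.3 (1) (p. 153)] [cite: Kenku1982, proof of Thm. 1, pp. 200–201] -/
theorem noCyclic1369_jm9317 {W W' : WeierstrassCurve ℚ} [W.IsElliptic] [W'.IsElliptic]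
    (ψ : Isogeny W W') (hψ : ψ.IsCyclic) (hq : ψ.degree = 1369) : W.j ≠ -9317 := by
  have hj : (((⟨1, 1, 1, -8, 6⟩ : WeierstrassCurve ℤ)).c₄ : ℚ) ^ 3 /
      (((⟨1, 1, 1, -8, 6⟩ : WeierstrassCurve ℤ)).Δ : ℚ) = -9317 := by
    norm_num [WeierstrassCurve.Δ, WeierstrassCurve.c₄, WeierstrassCurve.b₂, WeierstrassCurve.b₄,
      WeierstrassCurve.b₆, WeierstrassCurve.b₈]
  have hnr : ∀ t : ZMod 1369, t ^ 2 - ((-16 : ℤ) : ZMod 1369) * t + ((397 : ℕ) : ZMod 1369) ≠ 0 := by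
    simpa using noroot_E37_jm9317_397_1369
  rw [← hj]
  haveI : Fact (Nat.Prime 397) := ⟨by norm_num⟩
  haveI : Fact (Nat.Prime 37) := ⟨by norm_num⟩
  exact j_ne_of_primePow_row _ (B := 3) (by decide +kernel) (by decide +kernel) (by decide +kernel)
    (by decide +kernel) (ℓ := 397) (by decide +kernel) card_E37_jm9317_397 (p := 37)
    (k := 2) (by norm_num) (by norm_num) (by norm_num) hnr ψ hψ hq

/-- No cyclic `ℚ`-isogeny of degree `1369 = 37²` out of an elliptic curve over `ℚ` with
`j = -162677523113838677`: model `[1, 1, 1, -208083, -36621194]` (`Δ = -6125`), witness `ℓ = 397`, `#Ẽ(𝔽_397) = 414`,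
`a_397 = -16`, and `X² - (-16)X + 397` has no root modulo `1369` (`noroot_E37_jm162677523113838677_397_1369`).
[cite: Mazur1978, §6 Prop. 6.3 (1) (p. 153)] [cite: Kenku1982, proof of Thm. 1, pp. 200–201] -/
theorem noCyclic1369_jm162677523113838677 {W W' : WeierstrassCurve ℚ} [W.IsElliptic] [W'.IsElliptic]
    (ψ : Isogeny W W') (hψ : ψ.IsCyclic) (hq : ψ.degree = 1369) : W.j ≠ -162677523113838677 := by
  have hj : (((⟨1, 1, 1, -208083, -36621194⟩ : WeierstrassCurve ℤ)).c₄ : ℚ) ^ 3 /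
      (((⟨1, 1, 1, -208083, -36621194⟩ : WeierstrassCurve ℤ)).Δ : ℚ) = -162677523113838677 := by
    norm_num [WeierstrassCurve.Δ, WeierstrassCurve.c₄, WeierstrassCurve.b₂, WeierstrassCurve.b₄,
      WeierstrassCurve.b₆, WeierstrassCurve.b₈]
  have hnr : ∀ t : ZMod 1369, t ^ 2 - ((-16 : ℤ) : ZMod 1369) * t + ((397 : ℕ) : ZMod 1369) ≠ 0 := by
    simpa using noroot_E37_jm162677523113838677_397_1369
  rw [← hj]
  haveI : Fact (Nat.Prime 397) := ⟨by norm_num⟩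
  haveI : Fact (Nat.Prime 37) := ⟨by norm_num⟩
  exact j_ne_of_primePow_row _ (B := 3) (by decide +kernel) (by decide +kernel) (by decide +kernel)
    (by decide +kernel) (ℓ := 397) (by decide +kernel) card_E37_jm162677523113838677_397 (p := 37)
    (k := 2) (by norm_num) (by norm_num) (by norm_num) hnr ψ hψ hq

/-- No cyclic `ℚ`-isogeny of degree `1849 = 43²` out of an elliptic curve over `ℚ` with
`j = -884736000`: model `[0, 0, 1, -860, 9707]` (`Δ = -79507`), witness `ℓ = 11`, `#Ẽ(𝔽_11) = 13`,
`a_11 = -1`, and `X² - (-1)X + 11` has no root modulo `1849` (`noroot_E43_jm884736000_11_1849`).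
[cite: Mazur1978, §6 Prop. 6.3 (1) (p. 153)] [cite: Kenku1982, proof of Thm. 1, pp. 200–201] -/
theorem noCyclic1849_jm884736000 {W W' : WeierstrassCurve ℚ} [W.IsElliptic] [W'.IsElliptic]
    (ψ : Isogeny W W') (hψ : ψ.IsCyclic) (hq : ψ.degree = 1849) : W.j ≠ -884736000 := by
  have hj : (((⟨0, 0, 1, -860, 9707⟩ : WeierstrassCurve ℤ)).c₄ : ℚ) ^ 3 /
      (((⟨0, 0, 1, -860, 9707⟩ : WeierstrassCurve ℤ)).Δ : ℚ) = -884736000 := by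
    norm_num [WeierstrassCurve.Δ, WeierstrassCurve.c₄, WeierstrassCurve.b₂, WeierstrassCurve.b₄,
      WeierstrassCurve.b₆, WeierstrassCurve.b₈]
  have hnr : ∀ t : ZMod 1849, t ^ 2 - ((-1 : ℤ) : ZMod 1849) * t + ((11 : ℕ) : ZMod 1849) ≠ 0 := by
    simpa using noroot_E43_jm884736000_11_1849
  rw [← hj]
  haveI : Fact (Nat.Prime 11) := ⟨by norm_num⟩
  haveI : Fact (Nat.Prime 43) := ⟨by norm_num⟩
  exact j_ne_of_primePow_row _ (B := 3) (by decide +kernel) (by decide +kernel) (by decide +kernel)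
    (by decide +kernel) (ℓ := 11) (by decide +kernel) card_E43_jm884736000_11 (p := 43)
    (k := 2) (by norm_num) (by norm_num) (by norm_num) hnr ψ hψ hq

/-- No cyclic `ℚ`-isogeny of degree `4489 = 67²` out of an elliptic curve over `ℚ` with
`j = -147197952000`: model `[0, 0, 1, -7370, 243528]` (`Δ = -300763`), witness `ℓ = 17`, `#Ẽ(𝔽_17) = 19`,
`a_17 = -1`, and `X² - (-1)X + 17` has no root modulo `4489` (`noroot_E67_jm147197952000_17_4489`).
[cite: Mazur1978, §6 Prop. 6.3 (1) (p. 153)] [cite: Kenku1982, proof of Thm. 1, pp. 200–201] -/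
theorem noCyclic4489_jm147197952000 {W W' : WeierstrassCurve ℚ} [W.IsElliptic] [W'.IsElliptic]
    (ψ : Isogeny W W') (hψ : ψ.IsCyclic) (hq : ψ.degree = 4489) : W.j ≠ -147197952000 := by
  have hj : (((⟨0, 0, 1, -7370, 243528⟩ : WeierstrassCurve ℤ)).c₄ : ℚ) ^ 3 /
      (((⟨0, 0, 1, -7370, 243528⟩ : WeierstrassCurve ℤ)).Δ : ℚ) = -147197952000 := by
    norm_num [WeierstrassCurve.Δ, WeierstrassCurve.c₄, WeierstrassCurve.b₂, WeierstrassCurve.b₄,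
      WeierstrassCurve.b₆, WeierstrassCurve.b₈]
  have hnr : ∀ t : ZMod 4489, t ^ 2 - ((-1 : ℤ) : ZMod 4489) * t + ((17 : ℕ) : ZMod 4489) ≠ 0 := by
    simpa using noroot_E67_jm147197952000_17_4489
  rw [← hj]
  haveI : Fact (Nat.Prime 17) := ⟨by norm_num⟩
  haveI : Fact (Nat.Prime 67) := ⟨by norm_num⟩
  exact j_ne_of_primePow_row _ (B := 3) (by decide +kernel) (by decide +kernel) (by decide +kernel)
    (by decide +kernel) (ℓ := 17) (by decide +kernel) card_E67_jm147197952000_17 (p := 67)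
    (k := 2) (by norm_num) (by norm_num) (by norm_num) hnr ψ hψ hq

/-- No cyclic `ℚ`-isogeny of degree `26569 = 163²` out of an elliptic curve over `ℚ` with
`j = -262537412640768000`: model `[0, 0, 1, -2174420, 1234136692]` (`Δ = -4330747`), witness `ℓ = 41`, `#Ẽ(𝔽_41) = 43`,
`a_41 = -1`, and `X² - (-1)X + 41` has no root modulo `26569` (`noroot_E163_jm262537412640768000_41_26569`).
[cite: Mazur1978, §6 Prop. 6.3 (1) (p. 153)] [cite: Kenku1982, proof of Thm. 1, pp. 200–201] -/
theorem noCyclic26569_jm262537412640768000 {W W' : WeierstrassCurve ℚ} [W.IsElliptic] [W'.IsElliptic]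
    (ψ : Isogeny W W') (hψ : ψ.IsCyclic) (hq : ψ.degree = 26569) : W.j ≠ -262537412640768000 := by
  have hj : (((⟨0, 0, 1, -2174420, 1234136692⟩ : WeierstrassCurve ℤ)).c₄ : ℚ) ^ 3 /
      (((⟨0, 0, 1, -2174420, 1234136692⟩ : WeierstrassCurve ℤ)).Δ : ℚ) = -262537412640768000 := by
    norm_num [WeierstrassCurve.Δ, WeierstrassCurve.c₄, WeierstrassCurve.b₂, WeierstrassCurve.b₄,
      WeierstrassCurve.b₆, WeierstrassCurve.b₈]
  have hnr : ∀ t : ZMod 26569, t ^ 2 - ((-1 : ℤ) : ZMod 26569) * t + ((41 : ℕ) : ZMod 26569) ≠ 0 := by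
    simpa using noroot_E163_jm262537412640768000_41_26569
  rw [← hj]
  haveI : Fact (Nat.Prime 41) := ⟨by norm_num⟩
  haveI : Fact (Nat.Prime 163) := ⟨by norm_num⟩
  exact j_ne_of_primePow_row _ (B := 4) (by decide +kernel) (by decide +kernel) (by decide +kernel)
    (by decide +kernel) (ℓ := 41) (by decide +kernel) card_E163_jm262537412640768000_41 (p := 163)
    (k := 2) (by norm_num) (by norm_num) (by norm_num) hnr ψ hψ hq

end Literature.NumberTheory.EllipticCurves.KenkuLevelsCert

end
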